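import Mathlib
import Literature.Computability.AlgebraicComplexity.NestFreeMatchingPoly
import HarnessLib

/-!
# The queue-grid face of `NFP(2n)` — reduction of the face–projection statement to finite combinatorics

Helper file for the support item stmt-ValiantsHypothesis-26254 (`Theses.FifoMatching.NFPolytopeQuasiPolyXC`,
K1 of the 21181-side plan of record; line of record `Cruxes/NNLinearDegreeCofactorHard/Lines/queue_grid_face.lean`,
val-idea-7 g6, crit-3 VERDICT #18).  Honesty: nothing here is a lower bound; stmt-23918 / stmt-24468 are CLOSED and
untouched, stmt-21181 and K1 stay OPEN, VP ≠ VNP is not moved.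

The line's open input (A) `QueueGridFaceProjection` says: an affine section of the nest-free perfect-matching
polytope `NFP(2n) = Newt(NN_n) = conv{χ_M : M a nest-free perfect matching of [2n]}` maps, by a coordinate
restriction `x ↦ x ∘ f`, EXACTLY onto the pair-pattern polytope `conv (range patternVec)` of the `r × r` queue grid.
This file proves, once and for all, the CONVEX-GEOMETRIC half of that statement, so that what is left for the
gadget (layout B of the memo `Lines/internal_cofactor-NEXT-RUNG-dual.md` §8.3) is finite combinatorics only:

* `convexHull_inter_setOf_eq_of_le` — a face of a convex hull cut out by VALID equalities
  (`δ_t ≤ ℓ_t` on the generating set) is the convex hull of the generators on it [folklore; Ziegler, Lectures on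
  Polytopes, Prop. 2.3 (i)];
* `realSupport_nestFreeMatchingPoly` — the real points of `supp NN_n` are the arc-indicator vectors
  `χ_M = (arcExponent M : ℝ^{2n × 2n})` of the nest-free perfect matchings `M`;
* `face_projection_of_gadget` — MAIN: given gadget data (`design : β → matchings`, an allowed-arc set `E'`, a
  coordinate map `f : κ → arcs`, a pattern `P : β → κ → ℝ`) with
  (h1) every `design X` is a nest-free perfect matching, (h2) its arcs lie in `E'`,
  (h3) RIGIDITY — every nest-free perfect matching all of whose arcs lie in `E'` is a design, and
  (h4) READ-OUT — `χ_{design X} ∘ f = P X`,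
  there are finitely many equations `cv_t · x = δ_t` (namely `x_a = 0`, `a ∉ E'`) such that
  `(x ↦ x ∘ f) '' (NFP(2n) ∩ {cv_t · x = δ_t}) = conv (range P)`.
  The left side is literally the body of `QueueGridFaceProjection` (`newt`, `suppPts`, `realOf` unfolded) and
  of the route decl (which inlines `nestFreeMatchingPoly` by `rfl`); with `P := patternVec r` the right side is
  `queueGridPP r`.
* `face_projection_of_gadget_prop` — the same with a `Prop`-valued read-out `C X q` (pattern `= if C then 1 else 0`,
  the shape of `patternVec`).

USAGE (checked in this seat's scratch against verbatim copies of the line file's `newt`/`queueGridPP`/`patternVec`/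
`QueueGridFaceProjection`): from `face_projection_of_gadget_prop design E' f C h1 h2 h3 h4` with
`C X q := (qgEdge r q.1 = true ∧ bits X q.1.1 = q.2.1 ∧ bits X q.1.2 = q.2.2)` for a SURJECTIVE `bits : β → (QGV r → Bool)`
(e.g. `β = (QGV r → Bool)`, `bits = id`) one gets the `r, n` instance of `QueueGridFaceProjection` by
`refine ⟨k, cv, δ, f, ?_⟩; unfold newt suppPts realOf queueGridPP; rw [h]; congr 1; ext v; simp only [Set.mem_range]`
and surjectivity of `bits` — so (A) for general `r` is EXACTLY: for every `r ≥ 1`, `n ≥ (r+1)(2r+1)`, gadget data with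
(h1)–(h4).

No new definitions.  References: G. M. Ziegler, *Lectures on Polytopes*, GTM 152, Springer 1995, Prop. 2.3;
Fiorini–Massar–Pokutta–Tiwary–de Wolf, J. ACM 62 (2015), Lemma 9 (faces and projections of EFs — consumed downstream by
`HasEFOfSize.inter_eqs` / `.image_comp`, not here).
-/

noncomputable section

open Finset Matrix MvPolynomial
open scoped NNReal

-- Sub = Summit single-conjunct layout: the duplicated namespace component is mandated by the tree.
set_option linter.dupNamespace false

namespace Summit.ValiantsHypothesis.ValiantsHypothesis.Theorems.FifoMatching.QueueGridFace

open Literature.Computability.AlgebraicComplexity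

/-! ## §1 Faces of convex hulls cut out by valid equalities -/

section Face

variable {E : Type*} [AddCommGroup E] [Module ℝ E]

/-- The solution set of a family of linear equations `ℓ_t x = δ_t` is convex. [folklore] -/
theorem convex_setOf_forall_eq {T : Type*} (ℓ : T → E →ₗ[ℝ] ℝ) (δ : T → ℝ) :
    Convex ℝ {x : E | ∀ t, ℓ t x = δ t} := by
  intro x hx y hy a b _ _ hab t
  simp only [Set.mem_setOf_eq] at hx hy
  rw [map_add, map_smul, map_smul, hx t, hy t, smul_eq_mul, smul_eq_mul, ← add_mul, hab, one_mul]

/-- **A face of a convex hull is the convex hull of the generators on it.** If every generator `y ∈ s`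
satisfies `δ_t ≤ ℓ_t y` for all `t` (the equations are VALID inequalities turned into equalities), then
`conv s ∩ {x | ∀ t, ℓ_t x = δ_t} = conv {y ∈ s | ∀ t, ℓ_t y = δ_t}`: in a convex combination lying on the face every
generator with positive weight lies on the face. [folklore; Ziegler 1995, Prop. 2.3 (i)] -/
theorem convexHull_inter_setOf_eq_of_le {T : Type*} (ℓ : T → E →ₗ[ℝ] ℝ) (δ : T → ℝ) (s : Set E)
    (hs : ∀ y ∈ s, ∀ t, δ t ≤ ℓ t y) :
    convexHull ℝ s ∩ {x | ∀ t, ℓ t x = δ t} = convexHull ℝ {y ∈ s | ∀ t, ℓ t y = δ t} := by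
  classical
  refine Set.Subset.antisymm ?_ ?_
  · rintro x ⟨hx, hxδ⟩
    rw [_root_.convexHull_eq] at hx
    obtain ⟨ι, τ, w, z, hw₀, hw₁, hz, rfl⟩ := hx
    -- every generator with nonzero weight lies on the face
    have key : ∀ t, ∀ i ∈ τ, w i ≠ 0 → ℓ t (z i) = δ t := by
      intro t i hi hwi
      have h1 : ℓ t (τ.centerMass w z) = δ t := hxδ t
      rw [Finset.centerMass_eq_of_sum_1 _ _ hw₁, map_sum] at h1
      simp only [map_smul, smul_eq_mul] at h1
      have hsum : ∑ j ∈ τ, w j * (ℓ t (z j) - δ t) = 0 := by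
        simp only [mul_sub, Finset.sum_sub_distrib, ← Finset.sum_mul, hw₁, one_mul, h1, sub_self]
      have hnn : ∀ j ∈ τ, 0 ≤ w j * (ℓ t (z j) - δ t) :=
        fun j hj => mul_nonneg (hw₀ j hj) (sub_nonneg.2 (hs _ (hz j hj) t))
      have hi0 := (Finset.sum_eq_zero_iff_of_nonneg hnn).1 hsum i hi
      rcases mul_eq_zero.1 hi0 with h | h
      · exact absurd h hwi
      · exact sub_eq_zero.1 h
    rw [← Finset.centerMass_filter_ne_zero]
    refine Finset.centerMass_mem_convexHull _ (fun i hi => hw₀ i (mem_filter.1 hi).1) ?_ ?_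
    · rw [Finset.sum_filter_ne_zero, hw₁]
      exact one_pos
    · intro i hi
      obtain ⟨hiτ, hwi⟩ := mem_filter.1 hi
      exact ⟨hz i hiτ, fun t => key t i hiτ hwi⟩
  · refine Set.subset_inter (convexHull_mono (Set.sep_subset _ _)) ?_
    exact convexHull_min (fun y hy => hy.2) (convex_setOf_forall_eq ℓ δ)

end Face

/-! ## §2 The generators of `NFP(2n)` -/

/-- The real points of `supp NN_n` (over `ℝ≥0`) are exactly the arc-indicator vectors
`χ_M = (arcExponent M : ℝ)` of the nest-free perfect matchings `M` of `Fin (2n)`. [folklore] -/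
theorem realSupport_nestFreeMatchingPoly (n : ℕ) :
    (fun d : (Fin (2 * n) × Fin (2 * n)) →₀ ℕ => fun i : Fin (2 * n) × Fin (2 * n) => ((d i : ℕ) : ℝ)) ''
        ((nestFreeMatchingPoly n ℝ≥0).support : Set ((Fin (2 * n) × Fin (2 * n)) →₀ ℕ))
      = (fun M : Fin (2 * n) → Fin (2 * n) => fun i : Fin (2 * n) × Fin (2 * n) =>
          ((arcExponent M i : ℕ) : ℝ)) '' (nestFreeMatchings (2 * n) : Set (Fin (2 * n) → Fin (2 * n))) := by
  rw [support_nestFreeMatchingPoly, Finset.coe_image, Set.image_image]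

/-- An arc `(i, M i)`, `i < M i`, has indicator `1` in `χ_M`. [folklore] -/
theorem arcExponent_arc {m : ℕ} (M : Fin m → Fin m) {i : Fin m} (hi : i < M i) :
    arcExponent M (i, M i) = 1 := by
  rw [arcExponent_apply, if_pos ⟨hi, rfl⟩]

/-- If `χ_M a ≠ 0` then `a = (i, M i)` is an arc of `M` (`i < M i`). [folklore] -/
theorem arc_of_arcExponent_ne_zero {m : ℕ} (M : Fin m → Fin m) {a : Fin m × Fin m}
    (ha : arcExponent M a ≠ 0) : a.1 < M a.1 ∧ M a.1 = a.2 := by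
  have h := arcExponent_apply M a.1 a.2
  rw [Prod.mk.eta] at h
  by_contra hc
  rw [h, if_neg hc] at ha
  exact ha rfl

/-! ## §3 The reduction -/

/-- **Face–projection reduction (MAIN).**  Gadget data: `design X` (one matching per bit pattern `X : β`), an
allowed-arc set `E'`, a coordinate map `f : κ → arcs` and a pattern `P : β → κ → ℝ`, with
(h1) every design a nest-free perfect matching, (h2) its arcs in `E'`, (h3) RIGIDITY: every nest-free perfect
matching supported on `E'` is a design, (h4) READ-OUT: `χ_{design X} ∘ f = P X`.  Then the coordinate face
`NFP(2n) ∩ {x_a = 0 : a ∉ E'}` — written, as `QueueGridFaceProjection` wants it, with a `Fin k`-indexed family of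
equations `cv_t · x = δ_t` — is mapped by `x ↦ x ∘ f` EXACTLY onto `conv (range P)`.  Proof: the face of the
`0/1`-hull is the hull of the vertices on it (`convexHull_inter_setOf_eq_of_le`, valid because `NFP ≥ 0`); those
vertices are the `χ_M` with `M` supported on `E'`, i.e. (h2, h3) the designs; and a linear map commutes with
`conv` (`LinearMap.image_convexHull`). [folklore assembly] -/
theorem face_projection_of_gadget {n : ℕ} {β κ : Type*}
    (design : β → (Fin (2 * n) → Fin (2 * n))) (E' : Set (Fin (2 * n) × Fin (2 * n)))
    (f : κ → Fin (2 * n) × Fin (2 * n)) (P : β → κ → ℝ)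
    (h1 : ∀ X, design X ∈ nestFreeMatchings (2 * n))
    (h2 : ∀ X i, i < design X i → (i, design X i) ∈ E')
    (h3 : ∀ M ∈ nestFreeMatchings (2 * n), (∀ i, i < M i → (i, M i) ∈ E') → ∃ X, design X = M)
    (h4 : ∀ X q, ((arcExponent (design X) (f q) : ℕ) : ℝ) = P X q) :
    ∃ (k : ℕ) (cv : Fin k → (Fin (2 * n) × Fin (2 * n) → ℝ)) (δ : Fin k → ℝ),
      (fun x : (Fin (2 * n) × Fin (2 * n)) → ℝ => x ∘ f) ''
          (convexHull ℝ ((fun d : (Fin (2 * n) × Fin (2 * n)) →₀ ℕ =>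
                fun i : Fin (2 * n) × Fin (2 * n) => ((d i : ℕ) : ℝ)) ''
              ((nestFreeMatchingPoly n ℝ≥0).support : Set ((Fin (2 * n) × Fin (2 * n)) →₀ ℕ)))
            ∩ {x | ∀ t, cv t ⬝ᵥ x = δ t})
        = convexHull ℝ (Set.range P) := by
  classical
  -- notation: `χ M` = the arc-indicator vector of `M` as a real point
  let χ : (Fin (2 * n) → Fin (2 * n)) → (Fin (2 * n) × Fin (2 * n)) → ℝ :=
    fun M i => ((arcExponent M i : ℕ) : ℝ)
  -- the forbidden arcs, enumerated by `Fin k`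
  set C : Finset (Fin (2 * n) × Fin (2 * n)) := Finset.univ.filter fun a => a ∉ E' with hC
  let e : Fin C.card → Fin (2 * n) × Fin (2 * n) := fun t => ((C.equivFin.symm t : C) : _)
  have he : ∀ t, e t ∉ E' := fun t => (mem_filter.1 (C.equivFin.symm t).2).2
  have heC : ∀ a, a ∉ E' → ∃ t, e t = a := fun a ha =>
    ⟨C.equivFin ⟨a, mem_filter.2 ⟨mem_univ _, ha⟩⟩, by simp [e]⟩
  refine ⟨C.card, fun t => Pi.single (e t) 1, fun _ => 0, ?_⟩
  -- the equation set is `{x | ∀ t, x (e t) = 0}`, a family of linear equations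
  let ℓ : Fin C.card → ((Fin (2 * n) × Fin (2 * n)) → ℝ) →ₗ[ℝ] ℝ := fun t => LinearMap.proj (e t)
  have hH : {x : (Fin (2 * n) × Fin (2 * n)) → ℝ | ∀ t, Pi.single (e t) (1 : ℝ) ⬝ᵥ x = 0}
      = {x | ∀ t, ℓ t x = (fun _ => (0 : ℝ)) t} := by
    ext x
    simp only [Set.mem_setOf_eq, single_dotProduct, one_mul, ℓ, LinearMap.coe_proj, Function.eval]
  -- the generators and their nonnegativity
  rw [realSupport_nestFreeMatchingPoly, hH]
  set S : Set ((Fin (2 * n) × Fin (2 * n)) → ℝ) :=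
    χ '' (nestFreeMatchings (2 * n) : Set (Fin (2 * n) → Fin (2 * n))) with hS
  have hs : ∀ y ∈ S, ∀ t, (fun _ => (0 : ℝ)) t ≤ ℓ t y := by
    rintro _ ⟨M, -, rfl⟩ t
    simp only [ℓ, LinearMap.coe_proj, Function.eval, χ]
    exact Nat.cast_nonneg _
  rw [convexHull_inter_setOf_eq_of_le ℓ (fun _ => (0 : ℝ)) S hs]
  -- the generators on the face are exactly the designs
  have hV : {y ∈ S | ∀ t, ℓ t y = (fun _ => (0 : ℝ)) t} = Set.range (χ ∘ design) := by
    ext y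
    simp only [Set.mem_setOf_eq, Set.mem_range, Function.comp_apply, ℓ, LinearMap.coe_proj,
      Function.eval]
    constructor
    · rintro ⟨⟨M, hM, rfl⟩, hy0⟩
      have harcs : ∀ i, i < M i → (i, M i) ∈ E' := by
        intro i hi
        by_contra hni
        obtain ⟨t, ht⟩ := heC _ hni
        have h0 := hy0 t
        rw [ht] at h0
        simp only [χ, arcExponent_arc M hi, Nat.cast_one] at h0
        exact one_ne_zero h0
      obtain ⟨X, hX⟩ := h3 M (mem_coe.1 hM) harcs
      exact ⟨X, by rw [hX]⟩
    · rintro ⟨X, rfl⟩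
      refine ⟨⟨design X, mem_coe.2 (h1 X), rfl⟩, fun t => ?_⟩
      simp only [χ, Nat.cast_eq_zero]
      by_contra hne
      obtain ⟨hlt, heq⟩ := arc_of_arcExponent_ne_zero (design X) hne
      have hmem := h2 X _ hlt
      rw [heq, Prod.mk.eta] at hmem
      exact he t hmem
  rw [hV]
  -- a linear map commutes with convex hulls
  have hL : (fun x : (Fin (2 * n) × Fin (2 * n)) → ℝ => x ∘ f) = ⇑(LinearMap.funLeft ℝ ℝ f) := rfl
  rw [hL, LinearMap.image_convexHull, ← Set.range_comp]
  have hP : (⇑(LinearMap.funLeft ℝ ℝ f) ∘ χ ∘ design) = P := by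
    funext X q
    simp only [Function.comp_apply, LinearMap.funLeft_apply, χ]
    exact h4 X q
  rw [hP]

/-- **Face–projection reduction, `Prop`-valued read-out.**  As `face_projection_of_gadget`, with the read-out
given as: `f q` is an arc of `design X` iff `C X q`; the pattern polytope is then
`conv (range fun X q => if C X q then 1 else 0)` — the shape of `patternVec` / `queueGridPP` of the line file.
[folklore assembly] -/
theorem face_projection_of_gadget_prop {n : ℕ} {β κ : Type*}
    (design : β → (Fin (2 * n) → Fin (2 * n))) (E' : Set (Fin (2 * n) × Fin (2 * n)))
    (f : κ → Fin (2 * n) × Fin (2 * n)) (C : β → κ → Prop) [∀ X q, Decidable (C X q)]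
    (h1 : ∀ X, design X ∈ nestFreeMatchings (2 * n))
    (h2 : ∀ X i, i < design X i → (i, design X i) ∈ E')
    (h3 : ∀ M ∈ nestFreeMatchings (2 * n), (∀ i, i < M i → (i, M i) ∈ E') → ∃ X, design X = M)
    (h4 : ∀ X q, ((f q).1 < design X (f q).1 ∧ design X (f q).1 = (f q).2) ↔ C X q) :
    ∃ (k : ℕ) (cv : Fin k → (Fin (2 * n) × Fin (2 * n) → ℝ)) (δ : Fin k → ℝ),
      (fun x : (Fin (2 * n) × Fin (2 * n)) → ℝ => x ∘ f) ''
          (convexHull ℝ ((fun d : (Fin (2 * n) × Fin (2 * n)) →₀ ℕ =>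
                fun i : Fin (2 * n) × Fin (2 * n) => ((d i : ℕ) : ℝ)) ''
              ((nestFreeMatchingPoly n ℝ≥0).support : Set ((Fin (2 * n) × Fin (2 * n)) →₀ ℕ)))
            ∩ {x | ∀ t, cv t ⬝ᵥ x = δ t})
        = convexHull ℝ (Set.range fun X q => if C X q then (1 : ℝ) else 0) := by
  refine face_projection_of_gadget design E' f _ h1 h2 h3 fun X q => ?_
  have h := arcExponent_apply (design X) (f q).1 (f q).2
  rw [Prod.mk.eta] at h
  rw [h]
  by_cases hc : C X q
  · rw [if_pos ((h4 X q).2 hc), if_pos hc, Nat.cast_one]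
  · rw [if_neg fun h' => hc ((h4 X q).1 h'), if_neg hc, Nat.cast_zero]

end Summit.ValiantsHypothesis.ValiantsHypothesis.Theorems.FifoMatching.QueueGridFace

end
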